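import Summits.Ventures.Crystal3D.Theorems.StickyWulffConstantPolycrystalWulffBoundFibreChimera

/-!
# The LINE-OF-SIGHT TRIMMING estimate: the part of an open convex cell within fibre-distance `ρ` of a
# disjoint open convex cell has volume `≤ ρ·(shadow of the common face) + o(ρ)` (for the general
# single-axis rung of `PolycrystalWulffBound`, line `PolyDensity`, crux `stmt-Ventures-19482`)

Route `StickyWulffConstant` of the venture `Summits/Ventures/Crystal3D`, second prover lane (poly-p2,
gen 10).  The multi-body chimera engine (`…MultiBodyChimera`, p636381) needs points of different pieces
on a common fibre line (direction = coordinate `1` of `Fin 3 → ℝ`) to be separated by more than the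
bodies' fibre offsets.  In the rung this is bought by removing from every cell `Q` of one lattice the
points within fibre-distance `ρ = r·2/√6` of a cell `P` of the other lattice:
`T_ρ = Q ∩ {x | ∃ s ∈ [−ρ, ρ], x + s·e₁ ∈ P}`.  This file bounds its volume SHARPLY per pair of cells:
* `lineTrim_fibre_diam_le` — on every fibre line the trimmed set has diameter `≤ ρ` (two disjoint
  convex subsets of `ℝ`);
* `volume_lineTrim_le_mul_volume_base` — Cavalieri: `|T_ρ| ≤ ρ · |B_ρ|`, `B_ρ ⊆ ℝ × ℝ` the set of base
  points `(x 0, x 2)` of fibre lines on which `Q` and `P` come within `ρ`;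
* `iInter_lineTrimBase_subset_shadow` — `⋂_n B_{1/(n+1)} ⊆ π(closure P ∩ closure Q)` (compactness);
* `volume_lineTrim_le_shadow` — **the estimate**: for every `ε > 0` there is `ρ₀ > 0` with
  `|T_ρ| ≤ ρ · (|π(closure P ∩ closure Q)| + ε)` for all `0 < ρ < ρ₀`, where `π x = (x 0, x 2)` and the
  shadow `|π(F)|` of the common face `F` is its planar Lebesgue measure (`= |⟪w, ν⟫|·area(F)` for a
  planar face with normal `ν` when the fibre direction is `w`; `= 0` for an edge or vertex contact).
Pure measure theory / convexity in `Fin 3 → ℝ`; no lattices.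
WHAT THIS IS NOT: the conversion of the shadow to facet areas, or the rung; the crux is not claimed.
-/

noncomputable section

namespace Summit.Ventures.Crystal3D.Theorems.Chimera

open MeasureTheory Set Filter Topology
open scoped ENNReal Pointwise

/-- the fibre direction `e₁ = (0, 1, 0)` of `Fin 3 → ℝ` -/
private theorem vec3_add_smul_e1 (ξ y t s : ℝ) :
    (![ξ, y, t] : Fin 3 → ℝ) + s • (![0, 1, 0] : Fin 3 → ℝ) = ![ξ, y + s, t] := by
  ext i; fin_cases i <;> simp

/-- The fibre `{y | (ξ, y, t) ∈ S}` of a convex set is convex. -/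
theorem convex_fibre3 {S : Set (Fin 3 → ℝ)} (hS : Convex ℝ S) (ξ t : ℝ) :
    Convex ℝ {y : ℝ | (![ξ, y, t] : Fin 3 → ℝ) ∈ S} := by
  intro y₁ hy₁ y₂ hy₂ a b ha hb hab
  have h := hS hy₁ hy₂ ha hb hab
  have e : a • (![ξ, y₁, t] : Fin 3 → ℝ) + b • (![ξ, y₂, t] : Fin 3 → ℝ) =
      ![ξ, a * y₁ + b * y₂, t] := by
    ext i; fin_cases i <;> simp [smul_eq_mul, ← add_mul, hab]
  rw [e] at h
  simpa [smul_eq_mul] using h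

/-- **Two disjoint convex subsets of `ℝ`: the points of one within distance `ρ` of the other form a
set of diameter `≤ ρ`.** -/
theorem diam_le_of_disjoint_convex_real {I J : Set ℝ} (hI : Convex ℝ I) (hJ : Convex ℝ J)
    (hIJ : Disjoint I J) (ρ : ℝ) :
    ∀ y ∈ {y ∈ J | ∃ s ∈ Icc (-ρ) ρ, y + s ∈ I}, ∀ y' ∈ {y ∈ J | ∃ s ∈ Icc (-ρ) ρ, y + s ∈ I},
      |y - y'| ≤ ρ := by
  -- symmetric claim: it suffices to treat `y ≤ y'`
  suffices key : ∀ y ∈ {y ∈ J | ∃ s ∈ Icc (-ρ) ρ, y + s ∈ I},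
      ∀ y' ∈ {y ∈ J | ∃ s ∈ Icc (-ρ) ρ, y + s ∈ I}, y ≤ y' → y' - y ≤ ρ by
    intro y hy y' hy'
    rcases le_total y y' with h | h
    · rw [abs_sub_comm, abs_of_nonneg (by linarith)]; exact key y hy y' hy' h
    · rw [abs_of_nonneg (by linarith)]; exact key y' hy' y hy h
  rintro y ⟨hyJ, s, hs, hysI⟩ y' ⟨hy'J, s', hs', hy's'I⟩ hyy'
  have hseg : Icc y y' ⊆ J := hJ.ordConnected.out hyJ hy'J
  have hI_seg : ∀ a ∈ I, ∀ b ∈ I, Icc a b ⊆ I := fun a ha b hb => hI.ordConnected.out ha hb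
  have notJ : ∀ z ∈ I, z ∉ Icc y y' := fun z hz hz' =>
    Set.disjoint_left.1 hIJ hz (hseg hz')
  -- case analysis on the signs of `s`, `s'`
  by_contra hcon
  push Not at hcon
  have h1 : y + s ∉ Icc y y' := notJ _ hysI
  have h2 : y' + s' ∉ Icc y y' := notJ _ hy's'I
  simp only [mem_Icc, not_and, not_le] at h1 h2
  rcases hs with ⟨hs1, hs2⟩
  rcases hs' with ⟨hs'1, hs'2⟩
  -- `y + s` lies outside `[y, y']`: either `s < 0` or `y + s > y'` (then `y' - y < s ≤ ρ`)
  by_cases hsl : y ≤ y + s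
  · have := h1 hsl; linarith
  · push Not at hsl
    -- `s < 0`; now `y' + s'`
    by_cases hs'l : y ≤ y' + s'
    · have h2' := h2 hs'l
      -- `y + s < y ≤ y' < y' + s'` : the segment `[y+s, y'+s'] ⊆ I` contains `y ∈ J`
      have hyI : y ∈ I := hI_seg _ hysI _ hy's'I ⟨by linarith, by linarith⟩
      exact Set.disjoint_left.1 hIJ hyI hyJ
    · push Not at hs'l
      -- `y' + s' < y ≤ y'` gives `y' - y < -s' ≤ ρ`
      linarith

/-- **Fibre diameter of the trimmed set.**  For disjoint convex `P, Q ⊆ Fin 3 → ℝ` and `ρ ≥ 0`, on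
every fibre line the set `Q ∩ {x | ∃ s ∈ [−ρ, ρ], x + s·e₁ ∈ P}` has diameter `≤ ρ`. -/
theorem lineTrim_fibre_diam_le {P Q : Set (Fin 3 → ℝ)} (hP : Convex ℝ P) (hQ : Convex ℝ Q)
    (hPQ : Disjoint P Q) (ρ ξ t : ℝ) :
    Metric.ediam {y : ℝ | (![ξ, y, t] : Fin 3 → ℝ) ∈
        Q ∩ {x | ∃ s ∈ Icc (-ρ) ρ, x + s • (![0, 1, 0] : Fin 3 → ℝ) ∈ P}} ≤ ENNReal.ofReal ρ := by
  refine Metric.ediam_le fun y hy y' hy' => ?_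
  have hfib := diam_le_of_disjoint_convex_real (convex_fibre3 hP ξ t) (convex_fibre3 hQ ξ t)
    (by
      rw [Set.disjoint_left]
      intro z hz hz'
      exact Set.disjoint_left.1 hPQ hz hz') ρ
  have conv : ∀ z, z ∈ {y : ℝ | (![ξ, y, t] : Fin 3 → ℝ) ∈
      Q ∩ {x | ∃ s ∈ Icc (-ρ) ρ, x + s • (![0, 1, 0] : Fin 3 → ℝ) ∈ P}} →
      z ∈ {y ∈ {y : ℝ | (![ξ, y, t] : Fin 3 → ℝ) ∈ Q} |
        ∃ s ∈ Icc (-ρ) ρ, y + s ∈ {y : ℝ | (![ξ, y, t] : Fin 3 → ℝ) ∈ P}} := by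
    rintro z ⟨hzQ, s, hs, hzP⟩
    refine ⟨hzQ, s, hs, ?_⟩
    simpa [vec3_add_smul_e1] using hzP
  have h := hfib y (conv y hy) y' (conv y' hy')
  rw [edist_dist, Real.dist_eq]
  exact ENNReal.ofReal_le_ofReal h

/-- the base set of the trimming: base points of fibre lines on which `Q` and `P` come within `ρ` -/
theorem isOpen_lineTrimBase {P Q : Set (Fin 3 → ℝ)} (hP : IsOpen P) (hQ : IsOpen Q) (ρ : ℝ) :
    IsOpen {p : ℝ × ℝ | ∃ y s, s ∈ Icc (-ρ) ρ ∧ (![p.1, y, p.2] : Fin 3 → ℝ) ∈ Q ∧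
      (![p.1, y + s, p.2] : Fin 3 → ℝ) ∈ P} := by
  have hcont : ∀ y : ℝ, Continuous fun p : ℝ × ℝ => (![p.1, y, p.2] : Fin 3 → ℝ) := by
    intro y
    refine continuous_pi fun i => ?_
    fin_cases i
    · simpa using continuous_fst
    · simpa using continuous_const
    · simpa using continuous_snd
  have e : {p : ℝ × ℝ | ∃ y s, s ∈ Icc (-ρ) ρ ∧ (![p.1, y, p.2] : Fin 3 → ℝ) ∈ Q ∧
      (![p.1, y + s, p.2] : Fin 3 → ℝ) ∈ P} =
      ⋃ (y : ℝ) (s : ℝ) (_ : s ∈ Icc (-ρ) ρ),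
        ((fun p : ℝ × ℝ => (![p.1, y, p.2] : Fin 3 → ℝ)) ⁻¹' Q ∩
          (fun p : ℝ × ℝ => (![p.1, y + s, p.2] : Fin 3 → ℝ)) ⁻¹' P) := by
    ext p
    simp only [mem_setOf_eq, mem_iUnion, mem_inter_iff, mem_preimage, exists_prop]
  rw [e]
  exact isOpen_iUnion fun y => isOpen_iUnion fun s => isOpen_iUnion fun _ =>
    ((hcont y).isOpen_preimage _ hQ).inter ((hcont (y + s)).isOpen_preimage _ hP)

/-- the trimmed set is open -/
theorem isOpen_lineTrim {P Q : Set (Fin 3 → ℝ)} (hP : IsOpen P) (hQ : IsOpen Q) (ρ : ℝ) :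
    IsOpen (Q ∩ {x : Fin 3 → ℝ | ∃ s ∈ Icc (-ρ) ρ, x + s • (![0, 1, 0] : Fin 3 → ℝ) ∈ P}) := by
  have e : {x : Fin 3 → ℝ | ∃ s ∈ Icc (-ρ) ρ, x + s • (![0, 1, 0] : Fin 3 → ℝ) ∈ P} =
      ⋃ (s : ℝ) (_ : s ∈ Icc (-ρ) ρ), (fun x => x + s • (![0, 1, 0] : Fin 3 → ℝ)) ⁻¹' P := by
    ext x; simp
  rw [e]
  exact hQ.inter (isOpen_iUnion fun s => isOpen_iUnion fun _ =>
    (continuous_id.add continuous_const).isOpen_preimage _ hP)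

/-- **Cavalieri for the trimmed set**: `|T_ρ| ≤ ρ·|B_ρ|`. -/
theorem volume_lineTrim_le_mul_volume_base {P Q : Set (Fin 3 → ℝ)} (hPo : IsOpen P) (hQo : IsOpen Q)
    (hP : Convex ℝ P) (hQ : Convex ℝ Q) (hPQ : Disjoint P Q) (ρ : ℝ) :
    volume (Q ∩ {x : Fin 3 → ℝ | ∃ s ∈ Icc (-ρ) ρ, x + s • (![0, 1, 0] : Fin 3 → ℝ) ∈ P}) ≤
      ENNReal.ofReal ρ * volume {p : ℝ × ℝ | ∃ y s, s ∈ Icc (-ρ) ρ ∧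
        (![p.1, y, p.2] : Fin 3 → ℝ) ∈ Q ∧ (![p.1, y + s, p.2] : Fin 3 → ℝ) ∈ P} := by
  set T : Set (Fin 3 → ℝ) := Q ∩ {x | ∃ s ∈ Icc (-ρ) ρ, x + s • (![0, 1, 0] : Fin 3 → ℝ) ∈ P}
    with hT
  set B : Set (ℝ × ℝ) := {p : ℝ × ℝ | ∃ y s, s ∈ Icc (-ρ) ρ ∧
    (![p.1, y, p.2] : Fin 3 → ℝ) ∈ Q ∧ (![p.1, y + s, p.2] : Fin 3 → ℝ) ∈ P} with hB
  have hTm : MeasurableSet T := (isOpen_lineTrim hPo hQo ρ).measurableSet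
  have hBm : MeasurableSet B := (isOpen_lineTrimBase hPo hQo ρ).measurableSet
  -- fibre bound
  have hfib : ∀ t ξ : ℝ, volume {y : ℝ | (![ξ, y, t] : Fin 3 → ℝ) ∈ T} ≤
      ENNReal.ofReal ρ * B.indicator 1 (ξ, t) := by
    intro t ξ
    by_cases hb : (ξ, t) ∈ B
    · rw [indicator_of_mem hb, Pi.one_apply, mul_one]
      exact (Real.volume_le_diam _).trans (lineTrim_fibre_diam_le hP hQ hPQ ρ ξ t)
    · have hempty : {y : ℝ | (![ξ, y, t] : Fin 3 → ℝ) ∈ T} = ∅ := by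
        ext y
        simp only [mem_setOf_eq, mem_empty_iff_false, iff_false]
        rintro ⟨hyQ, s, hs, hyP⟩
        apply hb
        refine ⟨y, s, hs, hyQ, ?_⟩
        simpa [vec3_add_smul_e1] using hyP
      rw [hempty, measure_empty]
      exact bot_le
  -- Cavalieri: slices, then fibres
  rw [volume_eq_lintegral_slice3 T hTm]
  have hslice : ∀ t, volume {p : ℝ × ℝ | (![p.1, p.2, t] : Fin 3 → ℝ) ∈ T} ≤
      ENNReal.ofReal ρ * ∫⁻ ξ, B.indicator 1 (ξ, t) := by
    intro t
    rw [volume_eq_lintegral_fibre2 _ (measurableSet_slice3 hTm t), ← lintegral_const_mul' _ _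
      ENNReal.ofReal_ne_top]
    refine lintegral_mono fun ξ => ?_
    rw [fibre_slice3]
    exact hfib t ξ
  calc ∫⁻ t, volume {p : ℝ × ℝ | (![p.1, p.2, t] : Fin 3 → ℝ) ∈ T}
      ≤ ∫⁻ t, ENNReal.ofReal ρ * ∫⁻ ξ, B.indicator 1 (ξ, t) := lintegral_mono hslice
    _ = ENNReal.ofReal ρ * ∫⁻ t, ∫⁻ ξ, B.indicator 1 (ξ, t) := by
        rw [lintegral_const_mul' _ _ ENNReal.ofReal_ne_top]
    _ = ENNReal.ofReal ρ * volume B := by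
        congr 1
        rw [Measure.volume_eq_prod, Measure.prod_apply_symm hBm]
        refine lintegral_congr fun t => ?_
        have hind : (fun ξ : ℝ => B.indicator (1 : ℝ × ℝ → ℝ≥0∞) (ξ, t)) =
            ((fun x : ℝ => (x, t)) ⁻¹' B).indicator 1 := by
          funext ξ; by_cases hξ : (ξ, t) ∈ B <;> simp [hξ]
        rw [hind, lintegral_indicator_one (hBm.preimage measurable_prodMk_right)]

/-- **The base sets shrink to the shadow of the common face**: if `Q` is bounded, every base point
lying in all `B_{1/(n+1)}` is the projection `(x 0, x 2)` of a point of `closure P ∩ closure Q`. -/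
theorem iInter_lineTrimBase_subset_shadow {P Q : Set (Fin 3 → ℝ)} (hQb : Bornology.IsBounded Q) :
    (⋂ n : ℕ, {p : ℝ × ℝ | ∃ y s, s ∈ Icc (-(1 / ((n : ℝ) + 1))) (1 / ((n : ℝ) + 1)) ∧
      (![p.1, y, p.2] : Fin 3 → ℝ) ∈ Q ∧ (![p.1, y + s, p.2] : Fin 3 → ℝ) ∈ P}) ⊆
      (fun x : Fin 3 → ℝ => (x 0, x 2)) '' (closure P ∩ closure Q) := by
  intro p hp
  simp only [mem_iInter, mem_setOf_eq] at hp
  choose y s hs hyQ hyP using hp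
  -- the points `x n = (p.1, y n, p.2) ∈ Q` have a cluster point in the compact `closure Q`
  have hK : IsCompact (closure Q) := hQb.isCompact_closure
  obtain ⟨x, hx, φ, hφ, hlim⟩ := hK.tendsto_subseq (x := fun n => (![p.1, y n, p.2] : Fin 3 → ℝ))
    (fun n => subset_closure (hyQ n))
  -- the shifted points `(p.1, y n + s n, p.2) ∈ P` converge to the same limit
  have hs0 : Tendsto (fun n => s (φ n)) atTop (𝓝 0) := by
    have h1 : Tendsto (fun n : ℕ => 1 / ((n : ℝ) + 1)) atTop (𝓝 0) :=
      tendsto_one_div_add_atTop_nhds_zero_nat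
    have h2 : Tendsto (fun n : ℕ => 1 / (((φ n : ℕ) : ℝ) + 1)) atTop (𝓝 0) :=
      h1.comp hφ.tendsto_atTop
    have h3 : Tendsto (fun n : ℕ => -(1 / (((φ n : ℕ) : ℝ) + 1))) atTop (𝓝 0) := by
      simpa using h2.neg
    exact tendsto_of_tendsto_of_tendsto_of_le_of_le h3 h2 (fun n => (hs (φ n)).1) (fun n => (hs (φ n)).2)
  have hlim' : Tendsto (fun n => (![p.1, y (φ n) + s (φ n), p.2] : Fin 3 → ℝ)) atTop (𝓝 x) := by
    have e : (fun n => (![p.1, y (φ n) + s (φ n), p.2] : Fin 3 → ℝ)) =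
        fun n => (![p.1, y (φ n), p.2] : Fin 3 → ℝ) + s (φ n) • (![0, 1, 0] : Fin 3 → ℝ) := by
      funext n; rw [vec3_add_smul_e1]
    rw [e, show x = x + (0 : ℝ) • (![0, 1, 0] : Fin 3 → ℝ) by simp]
    exact hlim.add (hs0.smul tendsto_const_nhds)
  have hxP : x ∈ closure P := mem_closure_of_tendsto hlim' (Eventually.of_forall fun n => hyP (φ n))
  -- coordinates `0` and `2` of the limit
  have h0 : x 0 = p.1 := by
    have := (continuous_apply 0).continuousAt.tendsto.comp hlim
    have hc : Tendsto (fun n : ℕ => p.1) atTop (𝓝 (x 0)) := by simpa [Function.comp_def] using this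
    exact tendsto_nhds_unique hc tendsto_const_nhds
  have h2 : x 2 = p.2 := by
    have := (continuous_apply 2).continuousAt.tendsto.comp hlim
    have hc : Tendsto (fun n : ℕ => p.2) atTop (𝓝 (x 2)) := by simpa [Function.comp_def] using this
    exact tendsto_nhds_unique hc tendsto_const_nhds
  exact ⟨x, ⟨hxP, hx⟩, by simp [h0, h2]⟩

/-- **The line-of-sight trimming estimate.**  For disjoint open convex `P, Q ⊆ Fin 3 → ℝ` with `Q`
bounded and every `ε > 0` there is `ρ₀ > 0` such that for all `0 < ρ < ρ₀` the part of `Q` within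
fibre-distance `ρ` of `P` has volume `≤ ρ · (|π(closure P ∩ closure Q)| + ε)`, `π x = (x 0, x 2)`. -/
theorem volume_lineTrim_le_shadow {P Q : Set (Fin 3 → ℝ)} (hPo : IsOpen P) (hQo : IsOpen Q)
    (hP : Convex ℝ P) (hQ : Convex ℝ Q) (hPQ : Disjoint P Q) (hQb : Bornology.IsBounded Q)
    {ε : ℝ} (hε : 0 < ε) :
    ∃ ρ₀ : ℝ, 0 < ρ₀ ∧ ∀ ρ : ℝ, 0 < ρ → ρ < ρ₀ →
      volume (Q ∩ {x : Fin 3 → ℝ | ∃ s ∈ Icc (-ρ) ρ, x + s • (![0, 1, 0] : Fin 3 → ℝ) ∈ P}) ≤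
        ENNReal.ofReal ρ *
          (volume ((fun x : Fin 3 → ℝ => (x 0, x 2)) '' (closure P ∩ closure Q)) + ENNReal.ofReal ε) := by
  -- the base sets
  set B : ℝ → Set (ℝ × ℝ) := fun ρ => {p : ℝ × ℝ | ∃ y s, s ∈ Icc (-ρ) ρ ∧
    (![p.1, y, p.2] : Fin 3 → ℝ) ∈ Q ∧ (![p.1, y + s, p.2] : Fin 3 → ℝ) ∈ P} with hB
  have hBmono : ∀ ρ ρ', ρ ≤ ρ' → B ρ ⊆ B ρ' := by
    rintro ρ ρ' h p ⟨y, s, hs, hq, hp⟩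
    exact ⟨y, s, ⟨by linarith [hs.1], by linarith [hs.2]⟩, hq, hp⟩
  have hBm : ∀ ρ, MeasurableSet (B ρ) := fun ρ => (isOpen_lineTrimBase hPo hQo ρ).measurableSet
  -- `B ρ` and the shadow lie in a fixed ball: finite measures
  obtain ⟨R, hR⟩ := (Metric.isBounded_iff_subset_closedBall (0 : Fin 3 → ℝ)).1 hQb
  have hR' : closure Q ⊆ Metric.closedBall (0 : Fin 3 → ℝ) R :=
    closure_minimal hR Metric.isClosed_closedBall
  have hproj : ∀ x ∈ Metric.closedBall (0 : Fin 3 → ℝ) R, (x 0, x 2) ∈ Metric.closedBall (0 : ℝ × ℝ) R := by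
    intro x hx
    rw [mem_closedBall_zero_iff] at hx
    have hR0 : 0 ≤ R := le_trans (norm_nonneg _) hx
    rw [pi_norm_le_iff_of_nonneg hR0] at hx
    rw [mem_closedBall_zero_iff, Prod.norm_def, max_le_iff]
    exact ⟨hx 0, hx 2⟩
  have hBsub : ∀ ρ, B ρ ⊆ Metric.closedBall (0 : ℝ × ℝ) R := by
    rintro ρ p ⟨y, s, -, hq, -⟩
    have := hproj _ (hR hq)
    simpa using this
  have hBfin : ∀ ρ, volume (B ρ) ≠ ⊤ := fun ρ =>
    (lt_of_le_of_lt (measure_mono (hBsub ρ)) measure_closedBall_lt_top).ne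
  set F : Set (ℝ × ℝ) := (fun x : Fin 3 → ℝ => (x 0, x 2)) '' (closure P ∩ closure Q) with hF
  have hFsub : F ⊆ Metric.closedBall (0 : ℝ × ℝ) R := by
    rintro p ⟨x, ⟨-, hxQ⟩, rfl⟩
    exact hproj x (hR' hxQ)
  have hFfin : volume F ≠ ⊤ := (lt_of_le_of_lt (measure_mono hFsub) measure_closedBall_lt_top).ne
  -- continuity from above along `ρ_n = 1/(n+1)`
  have hanti : Antitone fun n : ℕ => B (1 / ((n : ℝ) + 1)) := by
    intro n n' hnn'
    have hcast : (n : ℝ) ≤ n' := by exact_mod_cast hnn'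
    exact hBmono _ _ (one_div_le_one_div_of_le (by positivity) (by linarith))
  have hlim : Tendsto (fun n : ℕ => volume (B (1 / ((n : ℝ) + 1)))) atTop
      (𝓝 (volume (⋂ n : ℕ, B (1 / ((n : ℝ) + 1))))) :=
    tendsto_measure_iInter_atTop (fun n => (hBm _).nullMeasurableSet) hanti ⟨0, hBfin _⟩
  have hle : volume (⋂ n : ℕ, B (1 / ((n : ℝ) + 1))) ≤ volume F :=
    measure_mono (iInter_lineTrimBase_subset_shadow hQb)
  have hlt : volume (⋂ n : ℕ, B (1 / ((n : ℝ) + 1))) < volume F + ENNReal.ofReal ε :=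
    lt_of_le_of_lt hle (ENNReal.lt_add_right hFfin (by simpa using hε))
  obtain ⟨n₀, hn₀⟩ := (Filter.eventually_atTop.1 ((tendsto_order.1 hlim).2 _ hlt))
  refine ⟨1 / ((n₀ : ℝ) + 1), by positivity, fun ρ hρ hρ₀ => ?_⟩
  calc volume (Q ∩ {x : Fin 3 → ℝ | ∃ s ∈ Icc (-ρ) ρ, x + s • (![0, 1, 0] : Fin 3 → ℝ) ∈ P})
      ≤ ENNReal.ofReal ρ * volume (B ρ) :=
        volume_lineTrim_le_mul_volume_base hPo hQo hP hQ hPQ ρ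
    _ ≤ ENNReal.ofReal ρ * volume (B (1 / ((n₀ : ℝ) + 1))) := by
        gcongr
        exact hBmono _ _ hρ₀.le
    _ ≤ ENNReal.ofReal ρ * (volume F + ENNReal.ofReal ε) := by
        gcongr
        exact (hn₀ n₀ le_rfl).le

end Summit.Ventures.Crystal3D.Theorems.Chimera

end
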